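import Summits.NavierStokesRegularity.NavierStokesRegularity.Theorems.TypeIIInviscidRelaxationAxisymSwirlRegularCoreReynoldsScaled
import HarnessLib

/-!
# The plateau profile `G(s) = s^p (1+s²)^{−a} (1+s^L)^{−b}`: derivatives and the profile equation

Helper toward the crux `OneSidedRadialCriterion` (stmt-NavierStokesRegularity-19059; line `subcritical_core_reynolds`),
criterion side; continues `…CoreReynoldsScaled.lean` / `…CoreReynoldsThinCore.lean`.

WHY.  The admissible Reynolds level of a profile `F` in the self-similar reduction
(`RadialInflowSelfSimilar.hasSmoothExtensionPast_of_reynoldsProfile`) is `D_F = 1 + ξ²/2 − ξF″/F′ − mξF/F′`.  For the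
two-factor family `s^p(1+s²)^{−(p/2−m)}` (tree; rescaled in `…CoreReynoldsScaled`) the level inside the similarity
radius `ξ ≲ √(2Λ₀)` never exceeds the hump height `4(1−m)` (the profile approaches its far behaviour like `A − Bs^{−2}`,
and a plateau `A − Bs^{2−K}` carries level `K`).  A third factor `(1+s^L)^{−b}` supplies a plateau `A − Bs^{−L}`, i.e.
level up to `L + 2`, at any distance from the axis.  With `p = 2m + 2a + Lb` (far exponent `2m`) and
`N(s) = 2m + 2a/(1+s²) + bL/(1+s^L)` (`= sG′/G`), `M(s) = 4as²/(1+s²)² + bL²s^L/(1+s^L)²` (`= −sN′`), the admissible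
profile of `G(·/ε)` is, in closed form,

  `D(ξ) = 2 − N(s) + M(s)/N(s) + ε² s² (N(s) − 2m)/(2N(s))`,  `s = ξ/ε`

(readings: `≥ 2 − p` everywhere; `≈ L + 2` where `bL/(1+s^L)` dominates `N`; `≈ 2 + ε²a/(2m)·…` far out).

* `hasDerivAt_plateauProfile`, `hasDerivAt_plateauLogDeriv`, `hasDerivAt_dplateauProfile` — `G′ = Gℓ`,
  `ℓ = p/s − 2as/(1+s²) − bLs^L/(s(1+s^L))`, `ℓ′`, `(Gℓ)′ = G(ℓ² + ℓ′)`;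
* `hasDerivAt_scaledPlateau`, `derivs_scaledPlateau` — the rescaled profile `G(ξ/ε)`;
* `scaledPlateau_ode` — the profile equation holds with EQUALITY for `(G(·/ε), D)`.

The squeeze bounds and the criterion are in `…CoreReynoldsPlateau.lean`.  Honest label: criterion infrastructure
(comparison method); nothing here proves `OneSidedRadialCriterion`, `AxisymSwirlRegular` or NavierStokesRegularity. [new]
-/

noncomputable section

set_option linter.dupNamespace false

open Set Filter Topology Real
open Literature.Analysis.FluidPDE

namespace Summit.NavierStokesRegularity.NavierStokesRegularity.Theorems.RadialInflowPlateau

open Summit.NavierStokesRegularity.NavierStokesRegularity.Theorems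
open Summit.NavierStokesRegularity.NavierStokesRegularity.Theorems.ZhangBarrier
open Summit.NavierStokesRegularity.NavierStokesRegularity.Theorems.RadialInflowSelfSimilar

/-! ## §1 The profile `G(s) = s^p (1+s²)^{−a} (1+s^L)^{−b}` and its logarithmic derivative -/

/-- `(1 + x^L)′ = L x^L / x` at `x > 0`. -/
theorem hasDerivAt_one_add_rpow {L : ℝ} {s : ℝ} (hs : 0 < s) :
    HasDerivAt (fun x : ℝ => 1 + x ^ L) (L * s ^ L / s) s := by
  have h := (Real.hasDerivAt_rpow_const (p := L) (Or.inl hs.ne')).const_add 1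
  refine h.congr_deriv ?_
  rw [Real.rpow_sub_one hs.ne']
  ring

/-- `G′ = G · ℓ` on `(0,∞)`, `ℓ(s) = p/s − 2as/(1+s²) − bL s^L/(s(1+s^L))`. -/
theorem hasDerivAt_plateauProfile {p a b L : ℝ} {s : ℝ} (hs : 0 < s) :
    HasDerivAt (fun x : ℝ => x ^ p * (1 + x ^ 2) ^ (-a) * (1 + x ^ L) ^ (-b))
      (s ^ p * (1 + s ^ 2) ^ (-a) * (1 + s ^ L) ^ (-b) *
        (p / s - 2 * a * s / (1 + s ^ 2) - b * L * s ^ L / (s * (1 + s ^ L)))) s := by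
  have hb : 0 < 1 + s ^ 2 := by positivity
  have hL : 0 < 1 + s ^ L := by have := Real.rpow_pos_of_pos hs L; linarith
  have h1 : HasDerivAt (fun x : ℝ => x ^ p) (p * s ^ (p - 1)) s := Real.hasDerivAt_rpow_const (Or.inl hs.ne')
  have hden : HasDerivAt (fun x : ℝ => 1 + x ^ 2) (2 * s) s := by
    simpa using (hasDerivAt_pow 2 s).const_add 1
  have h2 : HasDerivAt (fun x : ℝ => (1 + x ^ 2) ^ (-a)) (2 * s * (-a) * (1 + s ^ 2) ^ (-a - 1)) s :=
    hden.rpow_const (Or.inl hb.ne')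
  have h3 : HasDerivAt (fun x : ℝ => (1 + x ^ L) ^ (-b)) (L * s ^ L / s * (-b) * (1 + s ^ L) ^ (-b - 1)) s :=
    (hasDerivAt_one_add_rpow hs).rpow_const (Or.inl hL.ne')
  have h12 : HasDerivAt (fun x : ℝ => x ^ p * (1 + x ^ 2) ^ (-a))
      (p * s ^ (p - 1) * (1 + s ^ 2) ^ (-a) + s ^ p * (2 * s * (-a) * (1 + s ^ 2) ^ (-a - 1))) s := h1.mul h2
  have h := h12.mul h3
  refine h.congr_deriv ?_
  rw [Real.rpow_sub_one hs.ne', Real.rpow_sub_one hb.ne', Real.rpow_sub_one hL.ne']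
  field_simp
  ring

/-- The logarithmic derivative `ℓ` and its derivative
`ℓ′(s) = −p/s² − 2a(1−s²)/(1+s²)² − bL s^L((L−1) − s^L)/(s²(1+s^L)²)`. -/
theorem hasDerivAt_plateauLogDeriv (p a b L : ℝ) {s : ℝ} (hs : 0 < s) :
    HasDerivAt (fun x : ℝ => p / x - 2 * a * x / (1 + x ^ 2) - b * L * x ^ L / (x * (1 + x ^ L)))
      (-p / s ^ 2 - 2 * a * (1 - s ^ 2) / (1 + s ^ 2) ^ 2
        - b * L * s ^ L * ((L - 1) - s ^ L) / (s ^ 2 * (1 + s ^ L) ^ 2)) s := by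
  have hb : (1 + s ^ 2) ≠ 0 := by positivity
  have hsL : 0 < s ^ L := Real.rpow_pos_of_pos hs L
  have hL : 0 < 1 + s ^ L := by linarith
  have h1 : HasDerivAt (fun x : ℝ => p / x) (-p / s ^ 2) s := by
    have h := (hasDerivAt_inv hs.ne').const_mul p
    refine (h.congr_of_eventuallyEq ?_).congr_deriv (by field_simp)
    exact Filter.Eventually.of_forall fun x => by simp [div_eq_mul_inv]
  have hden : HasDerivAt (fun x : ℝ => 1 + x ^ 2) (2 * s) s := by
    simpa using (hasDerivAt_pow 2 s).const_add 1
  have hnum : HasDerivAt (fun x : ℝ => 2 * a * x) (2 * a) s := by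
    simpa using (hasDerivAt_id s).const_mul (2 * a)
  have h2 := hnum.div hden hb
  -- third term: `b L x^L / (x (1 + x^L))`
  have hnum3 : HasDerivAt (fun x : ℝ => b * L * x ^ L) (b * L * (L * s ^ L / s)) s := by
    have h := (Real.hasDerivAt_rpow_const (p := L) (Or.inl hs.ne')).const_mul (b * L)
    refine h.congr_deriv ?_
    rw [Real.rpow_sub_one hs.ne']; ring
  have hden3 : HasDerivAt (fun x : ℝ => x * (1 + x ^ L)) (1 * (1 + s ^ L) + s * (L * s ^ L / s)) s :=
    (hasDerivAt_id s).mul (hasDerivAt_one_add_rpow hs)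
  have hden3ne : s * (1 + s ^ L) ≠ 0 := by positivity
  have h3 := hnum3.div hden3 hden3ne
  refine ((h1.sub h2).sub h3).congr_deriv ?_
  field_simp
  ring

/-- `(G·ℓ)′ = G (ℓ² + ℓ′)` on `(0,∞)`. -/
theorem hasDerivAt_dplateauProfile {p a b L : ℝ} {s : ℝ} (hs : 0 < s) :
    HasDerivAt (fun x : ℝ => x ^ p * (1 + x ^ 2) ^ (-a) * (1 + x ^ L) ^ (-b) *
        (p / x - 2 * a * x / (1 + x ^ 2) - b * L * x ^ L / (x * (1 + x ^ L))))
      (s ^ p * (1 + s ^ 2) ^ (-a) * (1 + s ^ L) ^ (-b) *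
        ((p / s - 2 * a * s / (1 + s ^ 2) - b * L * s ^ L / (s * (1 + s ^ L))) ^ 2
          + (-p / s ^ 2 - 2 * a * (1 - s ^ 2) / (1 + s ^ 2) ^ 2
            - b * L * s ^ L * ((L - 1) - s ^ L) / (s ^ 2 * (1 + s ^ L) ^ 2)))) s := by
  have h := (hasDerivAt_plateauProfile (p := p) (a := a) (b := b) (L := L) hs).mul
    (hasDerivAt_plateauLogDeriv p a b L hs)
  refine h.congr_deriv ?_
  ring

/-! ## §2 The rescaled profile `F(ξ) = G(ξ/ε)` and the profile equation (EQUALITY) -/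

/-- `F′(x) = G(x/ε) ℓ(x/ε) ε⁻¹` on `(0,∞)`. -/
theorem hasDerivAt_scaledPlateau {p a b L ε : ℝ} (hε : 0 < ε) {x : ℝ} (hx : 0 < x) :
    HasDerivAt (fun y : ℝ => (y / ε) ^ p * (1 + (y / ε) ^ 2) ^ (-a) * (1 + (y / ε) ^ L) ^ (-b))
      ((x / ε) ^ p * (1 + (x / ε) ^ 2) ^ (-a) * (1 + (x / ε) ^ L) ^ (-b) *
        (p / (x / ε) - 2 * a * (x / ε) / (1 + (x / ε) ^ 2)
          - b * L * (x / ε) ^ L / ((x / ε) * (1 + (x / ε) ^ L))) * ε⁻¹) x := by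
  have hs : 0 < x / ε := div_pos hx hε
  have hlin : HasDerivAt (fun y : ℝ => y / ε) ε⁻¹ x := by
    simpa [div_eq_mul_inv] using (hasDerivAt_id x).mul_const ε⁻¹
  exact (hasDerivAt_plateauProfile (p := p) (a := a) (b := b) (L := L) hs).comp x hlin

/-- `(F′)′(x) = G(x/ε) (ℓ² + ℓ′)(x/ε) ε⁻²` on `(0,∞)`. -/
theorem hasDerivAt_dscaledPlateau {p a b L ε : ℝ} (hε : 0 < ε) {x : ℝ} (hx : 0 < x) :
    HasDerivAt (fun y : ℝ => (y / ε) ^ p * (1 + (y / ε) ^ 2) ^ (-a) * (1 + (y / ε) ^ L) ^ (-b) *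
        (p / (y / ε) - 2 * a * (y / ε) / (1 + (y / ε) ^ 2)
          - b * L * (y / ε) ^ L / ((y / ε) * (1 + (y / ε) ^ L))) * ε⁻¹)
      ((x / ε) ^ p * (1 + (x / ε) ^ 2) ^ (-a) * (1 + (x / ε) ^ L) ^ (-b) *
        ((p / (x / ε) - 2 * a * (x / ε) / (1 + (x / ε) ^ 2)
            - b * L * (x / ε) ^ L / ((x / ε) * (1 + (x / ε) ^ L))) ^ 2
          + (-p / (x / ε) ^ 2 - 2 * a * (1 - (x / ε) ^ 2) / (1 + (x / ε) ^ 2) ^ 2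
            - b * L * (x / ε) ^ L * ((L - 1) - (x / ε) ^ L) / ((x / ε) ^ 2 * (1 + (x / ε) ^ L) ^ 2)))
        * ε⁻¹ * ε⁻¹) x := by
  have hs : 0 < x / ε := div_pos hx hε
  have hlin : HasDerivAt (fun y : ℝ => y / ε) ε⁻¹ x := by
    simpa [div_eq_mul_inv] using (hasDerivAt_id x).mul_const ε⁻¹
  exact ((hasDerivAt_dplateauProfile (p := p) (a := a) (b := b) (L := L) hs).comp x hlin).mul_const ε⁻¹

/-- `deriv F` and `iteratedDeriv 2 F` on `(0,∞)`. -/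
theorem derivs_scaledPlateau {p a b L ε : ℝ} (hε : 0 < ε) {x : ℝ} (hx : 0 < x) :
    deriv (fun y : ℝ => (y / ε) ^ p * (1 + (y / ε) ^ 2) ^ (-a) * (1 + (y / ε) ^ L) ^ (-b)) x
        = (x / ε) ^ p * (1 + (x / ε) ^ 2) ^ (-a) * (1 + (x / ε) ^ L) ^ (-b) *
          (p / (x / ε) - 2 * a * (x / ε) / (1 + (x / ε) ^ 2)
            - b * L * (x / ε) ^ L / ((x / ε) * (1 + (x / ε) ^ L))) * ε⁻¹ ∧
      iteratedDeriv 2 (fun y : ℝ => (y / ε) ^ p * (1 + (y / ε) ^ 2) ^ (-a) * (1 + (y / ε) ^ L) ^ (-b)) x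
        = (x / ε) ^ p * (1 + (x / ε) ^ 2) ^ (-a) * (1 + (x / ε) ^ L) ^ (-b) *
          ((p / (x / ε) - 2 * a * (x / ε) / (1 + (x / ε) ^ 2)
              - b * L * (x / ε) ^ L / ((x / ε) * (1 + (x / ε) ^ L))) ^ 2
            + (-p / (x / ε) ^ 2 - 2 * a * (1 - (x / ε) ^ 2) / (1 + (x / ε) ^ 2) ^ 2
              - b * L * (x / ε) ^ L * ((L - 1) - (x / ε) ^ L) / ((x / ε) ^ 2 * (1 + (x / ε) ^ L) ^ 2)))
          * ε⁻¹ * ε⁻¹ := by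
  refine ⟨(hasDerivAt_scaledPlateau (p := p) (a := a) (b := b) (L := L) hε hx).deriv, ?_⟩
  rw [show (2 : ℕ) = 1 + 1 from rfl, iteratedDeriv_succ, iteratedDeriv_one]
  have hev : deriv (fun y : ℝ => (y / ε) ^ p * (1 + (y / ε) ^ 2) ^ (-a) * (1 + (y / ε) ^ L) ^ (-b))
      =ᶠ[𝓝 x] fun y => (y / ε) ^ p * (1 + (y / ε) ^ 2) ^ (-a) * (1 + (y / ε) ^ L) ^ (-b) *
        (p / (y / ε) - 2 * a * (y / ε) / (1 + (y / ε) ^ 2)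
          - b * L * (y / ε) ^ L / ((y / ε) * (1 + (y / ε) ^ L))) * ε⁻¹ := by
    filter_upwards [Ioi_mem_nhds hx] with y hy using
      (hasDerivAt_scaledPlateau (p := p) (a := a) (b := b) (L := L) hε hy).deriv
  rw [hev.deriv_eq]
  exact (hasDerivAt_dscaledPlateau (p := p) (a := a) (b := b) (L := L) hε hx).deriv

/-- **The profile equation holds with EQUALITY** for the plateau Reynolds profile
`D(ξ) = 2 − N(s) + M(s)/N(s) + ε² s² (N(s) − 2m)/(2N(s))`, `s = ξ/ε`,
`N(s) = 2m + 2a/(1+s²) + bL/(1+s^L)`, `M(s) = 4as²/(1+s²)² + bL² s^L/(1+s^L)²` (`= sG′/G` and `−sN′`), provided the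
far exponent satisfies `p = 2m + 2a + Lb`. [new] -/
theorem scaledPlateau_ode {m a b L ε : ℝ} (hm : 0 < m) (ha : 0 ≤ a) (hb : 0 ≤ b) (hL : 0 ≤ L) (hε : 0 < ε)
    {ξ : ℝ} (hξ : 0 < ξ) :
    iteratedDeriv 2 (fun y : ℝ => (y / ε) ^ (2 * m + 2 * a + L * b) * (1 + (y / ε) ^ 2) ^ (-a)
        * (1 + (y / ε) ^ L) ^ (-b)) ξ
      + ((2 - (2 * m + 2 * a / (1 + (ξ / ε) ^ 2) + b * L / (1 + (ξ / ε) ^ L))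
            + (4 * a * (ξ / ε) ^ 2 / (1 + (ξ / ε) ^ 2) ^ 2 + b * L ^ 2 * (ξ / ε) ^ L / (1 + (ξ / ε) ^ L) ^ 2)
              / (2 * m + 2 * a / (1 + (ξ / ε) ^ 2) + b * L / (1 + (ξ / ε) ^ L))
            + ε ^ 2 * (ξ / ε) ^ 2 * ((2 * m + 2 * a / (1 + (ξ / ε) ^ 2) + b * L / (1 + (ξ / ε) ^ L)) - 2 * m)
              / (2 * (2 * m + 2 * a / (1 + (ξ / ε) ^ 2) + b * L / (1 + (ξ / ε) ^ L)))) / ξ - ξ⁻¹ - ξ / 2)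
        * deriv (fun y : ℝ => (y / ε) ^ (2 * m + 2 * a + L * b) * (1 + (y / ε) ^ 2) ^ (-a)
            * (1 + (y / ε) ^ L) ^ (-b)) ξ
      + m * ((ξ / ε) ^ (2 * m + 2 * a + L * b) * (1 + (ξ / ε) ^ 2) ^ (-a) * (1 + (ξ / ε) ^ L) ^ (-b))
      = 0 := by
  obtain ⟨h1, h2⟩ := derivs_scaledPlateau (p := 2 * m + 2 * a + L * b) (a := a) (b := b) (L := L) hε hξ
  rw [h1, h2]
  obtain ⟨s, hs, hsx⟩ : ∃ s : ℝ, 0 < s ∧ ξ / ε = s := ⟨ξ / ε, div_pos hξ hε, rfl⟩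
  have hξs : ξ = ε * s := by rw [← hsx]; field_simp
  rw [hsx, hξs]
  have hsL : 0 < s ^ L := Real.rpow_pos_of_pos hs L
  have hb2 : (1 + s ^ 2) ≠ 0 := by positivity
  have hbL : (1 + s ^ L) ≠ 0 := by positivity
  have hN : (2 * m + 2 * a / (1 + s ^ 2) + b * L / (1 + s ^ L)) ≠ 0 := by positivity
  have hs0 : s ≠ 0 := hs.ne'
  have hε0 : ε ≠ 0 := hε.ne'
  set Fv := s ^ (2 * m + 2 * a + L * b) * (1 + s ^ 2) ^ (-a) * (1 + s ^ L) ^ (-b) with hFv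
  set y := s ^ L with hy
  have key : (((2 * m + 2 * a + L * b) / s - 2 * a * s / (1 + s ^ 2) - b * L * y / (s * (1 + y))) ^ 2
          + (-(2 * m + 2 * a + L * b) / s ^ 2 - 2 * a * (1 - s ^ 2) / (1 + s ^ 2) ^ 2
            - b * L * y * ((L - 1) - y) / (s ^ 2 * (1 + y) ^ 2))) * ε⁻¹ * ε⁻¹
      + ((2 - (2 * m + 2 * a / (1 + s ^ 2) + b * L / (1 + y))
            + (4 * a * s ^ 2 / (1 + s ^ 2) ^ 2 + b * L ^ 2 * y / (1 + y) ^ 2)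
              / (2 * m + 2 * a / (1 + s ^ 2) + b * L / (1 + y))
            + ε ^ 2 * s ^ 2 * ((2 * m + 2 * a / (1 + s ^ 2) + b * L / (1 + y)) - 2 * m)
              / (2 * (2 * m + 2 * a / (1 + s ^ 2) + b * L / (1 + y)))) / (ε * s) - (ε * s)⁻¹ - ε * s / 2)
        * (((2 * m + 2 * a + L * b) / s - 2 * a * s / (1 + s ^ 2) - b * L * y / (s * (1 + y))) * ε⁻¹)
      + m = 0 := by
    rw [hy] at hbL hN ⊢
    field_simp
    ring
  linear_combination Fv * key

end Summit.NavierStokesRegularity.NavierStokesRegularity.Theorems.RadialInflowPlateau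

end
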